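import Literature.NumberTheory.EllipticCurves.QuadraticTwist
import HarnessLib

/-!
# The Legendre family along the anharmonic orbit: `E_{1−λ}` and `E_{1/λ}` are quadratic twists of `E_λ`

Classical (Silverman, *AEC* III §1, the six values `{λ, 1−λ, 1/λ, 1/(1−λ), λ/(λ−1), (λ−1)/λ}` with the same
`j`-invariant): for the Legendre equation `E_λ : y² = x(x−1)(x−λ)` (the tree's `⟨0, −(1+λ), 0, λ, 0⟩`, cf.
`NFPoint.legendreCurve`, `Cor22.thetaCurve`) and the tree's quadratic twist `WeierstrassCurve.quadraticTwist`
(`E_λ^{(d)} : y² = x(x−d)(x−dλ)`):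

* `legendre_quadraticTwist` — `E_λ^{(d)} = ⟨0, −d(1+λ), 0, d²λ, 0⟩`, i.e. `y² = x(x−d)(x−dλ)`;
* `legendre_one_sub_eq_smul_quadraticTwist_neg_one` — `E_{1−λ} = ⟨1, −1, 0, 0⟩ • E_λ^{(−1)}` (substitute
  `x ↦ x − 1` in `y² = x(x+1)(x+λ)`);
* `legendre_inv_eq_smul_quadraticTwist_self` — for `λ ≠ 0`, `E_{1/λ} = ⟨λ, 0, 0, 0⟩ • E_λ^{(λ)}` (rescale
  `y² = x(x−λ)(x−λ²)` by `u = λ`);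
* `legendre_div_sub_one_eq_smul_quadraticTwist` — for `λ ≠ 1`, `E_{λ/(λ−1)} = ⟨1−λ, λ(1−λ), 0, 0⟩ • E_λ^{(1−λ)}`;
hence (`exists_smul_…` forms) each of `E_{1−λ}`, `E_{1/λ}`, `E_{λ/(λ−1)}` is `F`-isomorphic to the twist of
`E_λ` by `−1`, `λ`, `1−λ` respectively, and the remaining two orbit members `1/(1−λ)`, `(λ−1)/λ` are reached by
composing these (every orbit member is a twist of `E_λ` by a signed product of `λ` and `1−λ`). Over a field
with `2 ≠ 0` (`[NeZero (2 : F)]`; the tree's `quadraticTwist` divides by `4`).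

Motivation (abc-iut cell, route IUTThetaPilot, FLAG F4 / finding F-c312-8-g3-1): the conjugates of the
Legendre curve of a `λ`-line point under `Gal(F_tpd/F_mod)` (the anharmonic group, `LambdaLineGalois`) are
these twists, so the Galois closure over `F_mod` of `F_tpd(√−1, E_λ[n])` lies in `F_tpd(√−1, √λ, √(λ−1),
E_λ[n])`, ramified over `F_tpd` only above `2`, `n` and the places where `λ` or `λ−1` is a non-unit. PROOF-ONLY
(no definitions); pure polynomial identities over any field. [cite: SilvermanAEC2009, III.1.7 p.49]
-/

namespace WeierstrassCurve

variable {F : Type*} [Field F] [NeZero (2 : F)]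

/-- `4 ≠ 0` when `2 ≠ 0`. [folklore] -/
private theorem four_ne_zero' : (4 : F) ≠ 0 := by
  rw [show (4 : F) = 2 * 2 by norm_num]; exact mul_ne_zero two_ne_zero two_ne_zero

/-- The quadratic twist of the Legendre equation: `E_λ^{(d)} = ⟨0, −d(1+λ), 0, d²λ, 0⟩`, i.e.
`y² = x³ − d(1+λ)x² + d²λx = x(x−d)(x−dλ)`. [cite: SilvermanAEC2009, X.2 Prop 2.4 p.318] -/
theorem legendre_quadraticTwist (t d : F) :
    (⟨0, -(1 + t), 0, t, 0⟩ : WeierstrassCurve F).quadraticTwist d = ⟨0, -(d * (1 + t)), 0, d ^ 2 * t, 0⟩ := by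
  have h4 : (4 : F) ≠ 0 := four_ne_zero'
  have h2 : (2 : F) ≠ 0 := two_ne_zero
  ext
  all_goals simp [quadraticTwist, b₂, b₄, b₆]
  all_goals (try field_simp)
  all_goals ring1

/-- **`E_{1−λ}` is the twist of `E_λ` by `−1`**: `⟨0, −(1+(1−λ)), 0, 1−λ, 0⟩ = ⟨1, −1, 0, 0⟩ • E_λ^{(−1)}`
(`E_λ^{(−1)} : y² = x(x+1)(x+λ)`, then `x ↦ x − 1`). [cite: SilvermanAEC2009, III.1.7 p.49] -/
theorem legendre_one_sub_eq_smul_quadraticTwist_neg_one (t : F) :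
    (⟨0, -(1 + (1 - t)), 0, 1 - t, 0⟩ : WeierstrassCurve F) =
      (⟨1, -1, 0, 0⟩ : VariableChange F) • (⟨0, -(1 + t), 0, t, 0⟩ : WeierstrassCurve F).quadraticTwist (-1) := by
  rw [legendre_quadraticTwist]
  ext
  all_goals simp [variableChange_a₁, variableChange_a₂, variableChange_a₃, variableChange_a₄, variableChange_a₆]
  all_goals ring1

/-- **`E_{1/λ}` is the twist of `E_λ` by `λ`** (`λ ≠ 0`): `⟨0, −(1+λ⁻¹), 0, λ⁻¹, 0⟩ = ⟨λ, 0, 0, 0⟩ • E_λ^{(λ)}`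
(`E_λ^{(λ)} : y² = x(x−λ)(x−λ²)`, then `(x, y) ↦ (λ²x, λ³y)`). [cite: SilvermanAEC2009, III.1.7 p.49] -/
theorem legendre_inv_eq_smul_quadraticTwist_self {t : F} (ht : t ≠ 0) :
    (⟨0, -(1 + t⁻¹), 0, t⁻¹, 0⟩ : WeierstrassCurve F) =
      (⟨Units.mk0 t ht, 0, 0, 0⟩ : VariableChange F) •
        (⟨0, -(1 + t), 0, t, 0⟩ : WeierstrassCurve F).quadraticTwist t := by
  rw [legendre_quadraticTwist]
  ext
  all_goals simp [variableChange_a₁, variableChange_a₂, variableChange_a₃, variableChange_a₄, variableChange_a₆]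
  all_goals (try field_simp)
  all_goals ring1

/-- **`E_{λ/(λ−1)}` is the twist of `E_λ` by `1−λ`** (`λ ≠ 1`):
`⟨0, −(1+λ/(λ−1)), 0, λ/(λ−1), 0⟩ = ⟨1−λ, λ(1−λ), 0, 0⟩ • E_λ^{(1−λ)}` (`E_λ^{(1−λ)} : y² = x(x−(1−λ))(x−(1−λ)λ)`,
then `x ↦ (1−λ)²x + λ(1−λ)`: the roots `0, 1, λ/(λ−1)` go to `λ(1−λ), 1−λ, 0`). [cite: SilvermanAEC2009, III.1.7 p.49] -/
theorem legendre_div_sub_one_eq_smul_quadraticTwist {t : F} (ht : t ≠ 1) :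
    (⟨0, -(1 + t / (t - 1)), 0, t / (t - 1), 0⟩ : WeierstrassCurve F) =
      (⟨Units.mk0 (1 - t) (sub_ne_zero.2 (Ne.symm ht)), t * (1 - t), 0, 0⟩ : VariableChange F) •
        (⟨0, -(1 + t), 0, t, 0⟩ : WeierstrassCurve F).quadraticTwist (1 - t) := by
  have h1 : t - 1 ≠ 0 := sub_ne_zero.2 ht
  have h1' : 1 - t ≠ 0 := sub_ne_zero.2 (Ne.symm ht)
  rw [legendre_quadraticTwist]
  ext
  all_goals simp [variableChange_a₁, variableChange_a₂, variableChange_a₃, variableChange_a₄, variableChange_a₆]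
  all_goals (try field_simp)
  all_goals first | ring1 | simp

/-- `∃`-form: `E_{1−λ} ≅ E_λ^{(−1)}` over `F`. [cite: SilvermanAEC2009, III.1.7 p.49] -/
theorem exists_smul_quadraticTwist_eq_legendre_one_sub (t : F) :
    ∃ C : VariableChange F,
      C • (⟨0, -(1 + t), 0, t, 0⟩ : WeierstrassCurve F).quadraticTwist (-1) = ⟨0, -(1 + (1 - t)), 0, 1 - t, 0⟩ :=
  ⟨_, (legendre_one_sub_eq_smul_quadraticTwist_neg_one t).symm⟩

/-- `∃`-form: `E_{1/λ} ≅ E_λ^{(λ)}` over `F` (`λ ≠ 0`). [cite: SilvermanAEC2009, III.1.7 p.49] -/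
theorem exists_smul_quadraticTwist_eq_legendre_inv {t : F} (ht : t ≠ 0) :
    ∃ C : VariableChange F,
      C • (⟨0, -(1 + t), 0, t, 0⟩ : WeierstrassCurve F).quadraticTwist t = ⟨0, -(1 + t⁻¹), 0, t⁻¹, 0⟩ :=
  ⟨_, (legendre_inv_eq_smul_quadraticTwist_self ht).symm⟩

/-- `∃`-form: `E_{λ/(λ−1)} ≅ E_λ^{(1−λ)}` over `F` (`λ ≠ 1`). [cite: SilvermanAEC2009, III.1.7 p.49] -/
theorem exists_smul_quadraticTwist_eq_legendre_div_sub_one {t : F} (ht : t ≠ 1) :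
    ∃ C : VariableChange F,
      C • (⟨0, -(1 + t), 0, t, 0⟩ : WeierstrassCurve F).quadraticTwist (1 - t) =
        ⟨0, -(1 + t / (t - 1)), 0, t / (t - 1), 0⟩ :=
  ⟨_, (legendre_div_sub_one_eq_smul_quadraticTwist ht).symm⟩

/-! ## The remaining two orbit members: `1/(1−λ)` and `(λ−1)/λ` -/

/-- **`E_{1/(1−λ)}` is the twist of `E_λ` by `λ−1`** (`λ ≠ 1`):
`⟨0, −(1+1/(1−λ)), 0, 1/(1−λ), 0⟩ = ⟨λ−1, λ−1, 0, 0⟩ • E_λ^{(λ−1)}` (`E_λ^{(λ−1)} : y² = x(x−(λ−1))(x−(λ−1)λ)`,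
then `x ↦ (λ−1)²x + (λ−1)`: the roots `0, 1, 1/(1−λ)` go to `λ−1, λ(λ−1), 0`). [cite: SilvermanAEC2009, III.1.7 p.49] -/
theorem legendre_inv_one_sub_eq_smul_quadraticTwist {t : F} (ht : t ≠ 1) :
    (⟨0, -(1 + (1 - t)⁻¹), 0, (1 - t)⁻¹, 0⟩ : WeierstrassCurve F) =
      (⟨Units.mk0 (t - 1) (sub_ne_zero.2 ht), t - 1, 0, 0⟩ : VariableChange F) •
        (⟨0, -(1 + t), 0, t, 0⟩ : WeierstrassCurve F).quadraticTwist (t - 1) := by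
  have h1 : t - 1 ≠ 0 := sub_ne_zero.2 ht
  have h1' : 1 - t ≠ 0 := sub_ne_zero.2 (Ne.symm ht)
  rw [legendre_quadraticTwist]
  ext
  all_goals simp [variableChange_a₁, variableChange_a₂, variableChange_a₃, variableChange_a₄, variableChange_a₆]
  all_goals (try field_simp)
  all_goals first | ring1 | simp

/-- **`E_{(λ−1)/λ}` is the twist of `E_λ` by `−λ`** (`λ ≠ 0`):
`⟨0, −(1+(λ−1)/λ), 0, (λ−1)/λ, 0⟩ = ⟨λ, −λ², 0, 0⟩ • E_λ^{(−λ)}` (`E_λ^{(−λ)} : y² = x(x+λ)(x+λ²)`, then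
`x ↦ λ²x − λ²`: the roots `0, 1, (λ−1)/λ` go to `−λ², 0, −λ`). [cite: SilvermanAEC2009, III.1.7 p.49] -/
theorem legendre_one_sub_inv_eq_smul_quadraticTwist {t : F} (ht : t ≠ 0) :
    (⟨0, -(1 + (t - 1) / t), 0, (t - 1) / t, 0⟩ : WeierstrassCurve F) =
      (⟨Units.mk0 t ht, -t ^ 2, 0, 0⟩ : VariableChange F) •
        (⟨0, -(1 + t), 0, t, 0⟩ : WeierstrassCurve F).quadraticTwist (-t) := by
  rw [legendre_quadraticTwist]
  ext
  all_goals simp [variableChange_a₁, variableChange_a₂, variableChange_a₃, variableChange_a₄, variableChange_a₆]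
  all_goals (try field_simp)
  all_goals first | ring1 | simp

/-- `∃`-form: `E_{1/(1−λ)} ≅ E_λ^{(λ−1)}` over `F` (`λ ≠ 1`). [cite: SilvermanAEC2009, III.1.7 p.49] -/
theorem exists_smul_quadraticTwist_eq_legendre_inv_one_sub {t : F} (ht : t ≠ 1) :
    ∃ C : VariableChange F,
      C • (⟨0, -(1 + t), 0, t, 0⟩ : WeierstrassCurve F).quadraticTwist (t - 1) =
        ⟨0, -(1 + (1 - t)⁻¹), 0, (1 - t)⁻¹, 0⟩ :=
  ⟨_, (legendre_inv_one_sub_eq_smul_quadraticTwist ht).symm⟩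

/-- `∃`-form: `E_{(λ−1)/λ} ≅ E_λ^{(−λ)}` over `F` (`λ ≠ 0`). [cite: SilvermanAEC2009, III.1.7 p.49] -/
theorem exists_smul_quadraticTwist_eq_legendre_one_sub_inv {t : F} (ht : t ≠ 0) :
    ∃ C : VariableChange F,
      C • (⟨0, -(1 + t), 0, t, 0⟩ : WeierstrassCurve F).quadraticTwist (-t) =
        ⟨0, -(1 + (t - 1) / t), 0, (t - 1) / t, 0⟩ :=
  ⟨_, (legendre_one_sub_inv_eq_smul_quadraticTwist ht).symm⟩

/-- **Summary along the anharmonic orbit** (`λ ≠ 0, 1`): each of the five non-trivial orbit members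
`1−λ, 1/λ, λ/(λ−1), 1/(1−λ), (λ−1)/λ` gives a Legendre curve `F`-isomorphic to the quadratic twist of `E_λ` by
`−1, λ, 1−λ, λ−1, −λ` respectively — all signed products of `λ` and `λ−1`, so all five twisting square roots lie
in `F(√−1, √λ, √(λ−1))`. [cite: SilvermanAEC2009, III.1.7 p.49] -/
theorem legendre_anharmonic_twists {t : F} (h0 : t ≠ 0) (h1 : t ≠ 1) :
    (∃ C : VariableChange F, C • (⟨0, -(1 + t), 0, t, 0⟩ : WeierstrassCurve F).quadraticTwist (-1) =
        ⟨0, -(1 + (1 - t)), 0, 1 - t, 0⟩) ∧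
    (∃ C : VariableChange F, C • (⟨0, -(1 + t), 0, t, 0⟩ : WeierstrassCurve F).quadraticTwist t =
        ⟨0, -(1 + t⁻¹), 0, t⁻¹, 0⟩) ∧
    (∃ C : VariableChange F, C • (⟨0, -(1 + t), 0, t, 0⟩ : WeierstrassCurve F).quadraticTwist (1 - t) =
        ⟨0, -(1 + t / (t - 1)), 0, t / (t - 1), 0⟩) ∧
    (∃ C : VariableChange F, C • (⟨0, -(1 + t), 0, t, 0⟩ : WeierstrassCurve F).quadraticTwist (t - 1) =
        ⟨0, -(1 + (1 - t)⁻¹), 0, (1 - t)⁻¹, 0⟩) ∧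
    (∃ C : VariableChange F, C • (⟨0, -(1 + t), 0, t, 0⟩ : WeierstrassCurve F).quadraticTwist (-t) =
        ⟨0, -(1 + (t - 1) / t), 0, (t - 1) / t, 0⟩) :=
  ⟨exists_smul_quadraticTwist_eq_legendre_one_sub t, exists_smul_quadraticTwist_eq_legendre_inv h0,
    exists_smul_quadraticTwist_eq_legendre_div_sub_one h1, exists_smul_quadraticTwist_eq_legendre_inv_one_sub h1,
    exists_smul_quadraticTwist_eq_legendre_one_sub_inv h0⟩

/-! ## Over a field containing the twisting square root: one variable change from `E_λ` -/

/-- **`E_λ^{(c)} = ⟨s⁻¹, 0, 0, 0⟩ • E_λ` when `s² = c`, `s ≠ 0`**: over a field containing a square root of the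
twisting scalar the quadratic twist of the Legendre equation is a change of variables of it (`x ↦ x/c`,
`y ↦ y/(cs)`). [cite: SilvermanAEC2009, X.2 Prop 2.4 p.318] -/
theorem legendre_quadraticTwist_eq_smul_of_sq {t c s : F} (hs : s ^ 2 = c) (hs0 : s ≠ 0) :
    (⟨0, -(1 + t), 0, t, 0⟩ : WeierstrassCurve F).quadraticTwist c =
      (⟨(Units.mk0 s hs0)⁻¹, 0, 0, 0⟩ : VariableChange F) • (⟨0, -(1 + t), 0, t, 0⟩ : WeierstrassCurve F) := by
  subst hs
  rw [legendre_quadraticTwist]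
  ext
  all_goals simp [variableChange_a₁, variableChange_a₂, variableChange_a₃, variableChange_a₄, variableChange_a₆]
  all_goals first | ring1 | (left; ring1)

/-- **Every anharmonic conjugate of `E_λ` is ONE change of variables of `E_λ` over any field containing the relevant
square root** (`λ ≠ 0, 1`): with `i² = −1`, `a² = λ`, `b² = λ − 1` in `F`, each of `E_{1−λ}`, `E_{1/λ}`,
`E_{λ/(λ−1)}`, `E_{1/(1−λ)}`, `E_{(λ−1)/λ}` equals `D • E_λ` for an explicit `D : VariableChange F` with entries in
`ℚ(λ, i, a, b)` — so their torsion points correspond under `VariableChange.pointEquiv` (coordinates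
`(u⁻²(x−r), u⁻³(y − s(x−r) − t))`). This is the form the Galois-closure computation
`F_mod-conjugates of F_tpd(√−1, E_λ[n]) ⊆ F_tpd(√−1, √λ, √(λ−1), E_λ[n])` consumes.
[cite: SilvermanAEC2009, III.1.7 p.49] -/
theorem legendre_anharmonic_smul_of_sqrts {t i a b : F} (h0 : t ≠ 0) (h1 : t ≠ 1) (hi : i ^ 2 = -1)
    (ha : a ^ 2 = t) (hb : b ^ 2 = t - 1) :
    (∃ D : VariableChange F, D • (⟨0, -(1 + t), 0, t, 0⟩ : WeierstrassCurve F) = ⟨0, -(1 + (1 - t)), 0, 1 - t, 0⟩) ∧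
    (∃ D : VariableChange F, D • (⟨0, -(1 + t), 0, t, 0⟩ : WeierstrassCurve F) = ⟨0, -(1 + t⁻¹), 0, t⁻¹, 0⟩) ∧
    (∃ D : VariableChange F, D • (⟨0, -(1 + t), 0, t, 0⟩ : WeierstrassCurve F) =
        ⟨0, -(1 + t / (t - 1)), 0, t / (t - 1), 0⟩) ∧
    (∃ D : VariableChange F, D • (⟨0, -(1 + t), 0, t, 0⟩ : WeierstrassCurve F) =
        ⟨0, -(1 + (1 - t)⁻¹), 0, (1 - t)⁻¹, 0⟩) ∧
    (∃ D : VariableChange F, D • (⟨0, -(1 + t), 0, t, 0⟩ : WeierstrassCurve F) =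
        ⟨0, -(1 + (t - 1) / t), 0, (t - 1) / t, 0⟩) := by
  have hi0 : i ≠ 0 := by rintro rfl; norm_num at hi
  have ha0 : a ≠ 0 := by rintro rfl; apply h0; simpa using ha.symm
  have hb0 : b ≠ 0 := by
    rintro rfl; apply h1; have : t - 1 = 0 := by simpa using hb.symm
    exact (sub_eq_zero.1 this)
  -- square roots of the five twisting scalars `−1, t, 1−t, t−1, −t`
  have s1 : i ^ 2 = -1 := hi
  have s2 : a ^ 2 = t := ha
  have s3 : (i * b) ^ 2 = 1 - t := by rw [mul_pow, hi, hb]; ring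
  have s4 : b ^ 2 = t - 1 := hb
  have s5 : (i * a) ^ 2 = -t := by rw [mul_pow, hi, ha]; ring
  refine ⟨?_, ?_, ?_, ?_, ?_⟩
  · obtain ⟨C, hC⟩ := exists_smul_quadraticTwist_eq_legendre_one_sub t
    exact ⟨C * ⟨(Units.mk0 i hi0)⁻¹, 0, 0, 0⟩, by rw [mul_smul, ← legendre_quadraticTwist_eq_smul_of_sq s1 hi0, hC]⟩
  · obtain ⟨C, hC⟩ := exists_smul_quadraticTwist_eq_legendre_inv h0
    exact ⟨C * ⟨(Units.mk0 a ha0)⁻¹, 0, 0, 0⟩, by rw [mul_smul, ← legendre_quadraticTwist_eq_smul_of_sq s2 ha0, hC]⟩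
  · obtain ⟨C, hC⟩ := exists_smul_quadraticTwist_eq_legendre_div_sub_one h1
    exact ⟨C * ⟨(Units.mk0 (i * b) (mul_ne_zero hi0 hb0))⁻¹, 0, 0, 0⟩,
      by rw [mul_smul, ← legendre_quadraticTwist_eq_smul_of_sq s3 (mul_ne_zero hi0 hb0), hC]⟩
  · obtain ⟨C, hC⟩ := exists_smul_quadraticTwist_eq_legendre_inv_one_sub h1
    exact ⟨C * ⟨(Units.mk0 b hb0)⁻¹, 0, 0, 0⟩, by rw [mul_smul, ← legendre_quadraticTwist_eq_smul_of_sq s4 hb0, hC]⟩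
  · obtain ⟨C, hC⟩ := exists_smul_quadraticTwist_eq_legendre_one_sub_inv h0
    exact ⟨C * ⟨(Units.mk0 (i * a) (mul_ne_zero hi0 ha0))⁻¹, 0, 0, 0⟩,
      by rw [mul_smul, ← legendre_quadraticTwist_eq_smul_of_sq s5 (mul_ne_zero hi0 ha0), hC]⟩

end WeierstrassCurve
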